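import Summits.HodgeConjecture.HodgeConjecture.Theorems.LimitExtensionHodgeFourfolds
import Literature.AlgebraicGeometry.HodgeTheory.HardLefschetzNFoldHolds
import Literature.AlgebraicGeometry.HodgeTheory.GysinKernelSplit
import Literature.AlgebraicGeometry.HodgeTheory.LefschetzOneOneOfGAGA
import Literature.AlgebraicGeometry.HodgeTheory.HodgeRiemannPolarizability
import Literature.AlgebraicGeometry.HodgeTheory.ComplexConjugationHolds
import Literature.NumberTheory.Transcendental.DeRhamTheoremMultiplicative

/-!
# Route LimitExtension · `HodgeFourfolds` (stmt-HodgeConjecture-10866) — hard Lefschetz discharged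

Companion of `Theorems/LimitExtensionHodgeFourfolds` (`hodgeFourfolds_of`, five hypotheses) and
`Theorems/LimitExtensionHodgeFourfoldsLeaves` (`hodgeFourfolds_of_leaves`): the hard Lefschetz
hypothesis `∀ X, nonempty_hardLefschetzNFold 4 X` of both — used only for the `(3,3)`-classes
(Murre 1977, Remark 1) — is now a THEOREM of the tree,
`Literature.AlgebraicGeometry.HodgeTheory.nonempty_hardLefschetzNFold_holds`
(`HodgeTheory/HardLefschetzNFoldHolds`: the hyperplane class of a smooth projective variety is a
rational multiple of a Kähler class, and Kähler classes have the hard Lefschetz property by the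
proved Hodge decomposition; relies on nothing unproved). Feeding it leaves the route decl
`HodgeFourfolds` CONDITIONAL on exactly

* `lefschetzOneOne_rational` — Lefschetz `(1,1)` (Voisin I Thm. 11.30; in the tree reduced EITHER to
  Serre's GAGA n° 20 Prop. 18 for line bundles, `lefschetzOneOne_rational_of_serreGAGA` with
  `serreGAGA_lineCocycle_iso_cartierDivisorCocycle_of_prop18`, OR to the Kodaira–Serre existence of
  sections of an algebraic twist, `lefschetzOneOne_rational_of_kodairaSerre` with the named fact
  `kodairaSerre_exists_globalSection_algebraicTwist`), used in codimension `1`, on the resolved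
  components of the supporting divisor in codimension `2`, and (through hard Lefschetz) in
  codimension `3`;
* `Deligne1974_ker_restrictCompl_eq_iSup_range_complexGysin` — Hodge III Cor. 8.2.8 (reduced to
  Prop. 8.2.7, `Deligne1974_ker_restrictCompl_eq_iSup_range_complexGysin_holds_of`);
* `Voisin2025_hodgeClass_lift_complexGysin` — Hodge classes lift along Gysin surjections (reduced to
  the polarizability `smoothProjective_hodgeStructure_isPolarizable`,
  `Voisin2025_hodgeClass_lift_complexGysin_holds_of`);
* the route's own open support item `SpecialisationOfAlgebraicity` (stmt-HodgeConjecture-2998),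

respectively, on the leaves of the fact DAG, on Serre's Prop. 18 / `serreGAGA_lineCocycle_iso_cartierDivisorCocycle`,
Deligne's Prop. 8.2.7, the polarizability, and stmt-2998 (`hodgeFourfolds_of_three_leaves`).
`hodgeFourfolds_of_two_binders` is the closable binder form `hodgeFourfolds_of_binders` with its
hard-Lefschetz binder discharged the same way (two classical binders — Lefschetz `(1,1)` on
fourfolds, divisor descent of rational `(2,2)`-classes — plus stmt-2998).
Each of the four is load-bearing for the printed proof (module docstring of
`LimitExtensionHodgeFourfolds`); none is implied by the item's hypotheses `HodgeModels`,
`LimitExtensionFour`, `HypersurfaceHodgeFour`, which speak only about `(2,2)`-classes and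
hypersurface fourfolds.
-/

noncomputable section

-- every declaration of this problem lives in `Summit.HodgeConjecture.HodgeConjecture.…` (summit = sub-problem)
set_option linter.dupNamespace false

open Literature.AlgebraicGeometry Literature.AlgebraicGeometry.Motives
open Literature.AlgebraicGeometry.HodgeTheory

namespace Summit.HodgeConjecture.HodgeConjecture.Theorems

/-- **`HodgeFourfolds` (stmt-HodgeConjecture-10866) from three named facts and the specialisation
lemma**, hard Lefschetz being discharged by `nonempty_hardLefschetzNFold_holds`: granted Lefschetz
`(1,1)` (`hL`), Deligne's Hodge III Cor. 8.2.8 (`hD`), the lifting of Hodge classes along Gysin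
surjections (`hV`) and the route's Hodge-free specialisation lemma (`hS`, stmt-HodgeConjecture-2998),
Hodge models + `LimitExtensionFour` + `HypersurfaceHodgeFour` give the Hodge conjecture for every
smooth projective complex fourfold (`hodgeFourfolds_of`; codimension `3` = the `(3,3)`-conjecture,
hard Lefschetz from codimension `1`, Murre 1977 Remark 1, now fed the tree's theorem).
[cite: Murre1977, Remark 1 (p. 230)] [cite: VoisinHodgeI2002, Thm. 6.25 and Thm. 11.30]
[cite: DeligneHodgeIII1974, Cor. 8.2.8] [cite: Voisin2025, Cor. 2.12] [cite: Thomas2005Nodes, Prop. 2] -/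
theorem hodgeFourfolds_of_facts (hL : lefschetzOneOne_rational)
    (hD : Deligne1974_ker_restrictCompl_eq_iSup_range_complexGysin)
    (hV : Voisin2025_hodgeClass_lift_complexGysin)
    (hS : Theses.LimitExtension.SpecialisationOfAlgebraicity) :
    Theses.LimitExtension.HodgeFourfolds :=
  hodgeFourfolds_of hL (fun X ↦ nonempty_hardLefschetzNFold_holds (n := 4) (X := X)) hD hV hS

/-- **`HodgeFourfolds` on the three remaining LEAVES of the fact DAG plus stmt-2998**: GAGA for
line bundles (`hG`, Serre n° 20 Prop. 18 ⟹ Lefschetz `(1,1)`), Deligne's Hodge III Prop. 8.2.7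
(`h827` ⟹ Cor. 8.2.8), the polarizability of the Hodge structures of smooth projective varieties
(`hpol` ⟹ Voisin 2025 Cor. 2.12) and the route's specialisation lemma (`hS`); hard Lefschetz is the
theorem `nonempty_hardLefschetzNFold_holds`; the three reductions are the tree's
`lefschetzOneOne_rational_of_serreGAGA`, `Deligne1974_ker_restrictCompl_eq_iSup_range_complexGysin_holds_of`
and `Voisin2025_hodgeClass_lift_complexGysin_holds_of` (fed the proved real Hodge models and de Rham
theorem), as in `hodgeFourfolds_of_leaves`.
[cite: SerreGAGA1956, n° 20 Prop. 18] [cite: DeligneHodgeIII1974, Prop. 8.2.7 and Cor. 8.2.8]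
[cite: VoisinHodgeI2002, Thm. 6.25, Thm. 6.32 and Thm. 11.30] [cite: Voisin2025, Prop. 2.11 and Cor. 2.12] -/
theorem hodgeFourfolds_of_three_leaves (hG : serreGAGA_lineCocycle_iso_cartierDivisorCocycle)
    (h827 : Deligne1974_ker_pullback_eq_ker_pullback_resolution)
    (hpol : smoothProjective_hodgeStructure_isPolarizable)
    (hS : Theses.LimitExtension.SpecialisationOfAlgebraicity) :
    Theses.LimitExtension.HodgeFourfolds :=
  hodgeFourfolds_of_facts (lefschetzOneOne_rational_of_serreGAGA hG)
    (Deligne1974_ker_restrictCompl_eq_iSup_range_complexGysin_holds_of h827)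
    (Voisin2025_hodgeClass_lift_complexGysin_holds_of exists_isReal_hodgeModel_holds
      (fun E _ _ _ ↦ Literature.NumberTheory.Transcendental.exists_deRhamIsoFamily_holds E) hpol)
    hS

/-- **`HodgeFourfolds` from TWO classical binders and the specialisation lemma** (the closable
restatement `hodgeFourfolds_of_binders` with its hard-Lefschetz binder `hRed` DISCHARGED): granted,
on smooth projective fourfolds, (i) Lefschetz `(1,1)` (`hLef`, Voisin I Thm. 11.30) and (ii) the
divisor descent in the middle degree — a rational `(2,2)`-class supported on a divisor is algebraic
(`hDiv`; Deligne Hodge III Cor. 8.2.8 + semisimplicity + Lefschetz `(1,1)` on the resolved divisor)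
— and the route's specialisation lemma `hS` (stmt-HodgeConjecture-2998), the cruxes
`LimitExtensionFour` and `HypersurfaceHodgeFour` (with Hodge models) give the Hodge conjecture for
every smooth projective fourfold. The reduction "codimension `4 - p ≤ 1` ⟹ codimension `p ≥ 3`"
is the tree's `mem_algebraicClasses_of_lt_of_nonempty` fed the theorem
`nonempty_hardLefschetzNFold_holds` (Murre 1977, Remark 1: the `(3,3)`-conjecture holds on every
fourfold). [cite: Murre1977, Remark 1 (p. 230)] [cite: VoisinHodgeI2002, Thm. 6.25 and Thm. 11.30]
[cite: DeligneHodgeIII1974, Cor. 8.2.8] [cite: Thomas2005Nodes, Prop. 2] -/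
theorem hodgeFourfolds_of_two_binders
    (hLef : ∀ X : SchemeOver ℂ, IsSmoothProjective 4 X → ∀ c : complexBetti X (2 * 1),
      IsRationalClass c → IsOfHodgeType 4 X (2 * 1) 1 1 c → c ∈ algebraicClasses X 1)
    (hDiv : ∀ X : SchemeOver ℂ, IsSmoothProjective 4 X → ∀ c : complexBetti X (2 * 2),
      IsRationalClass c → IsOfHodgeType 4 X (2 * 2) 2 2 c → c ∈ supportedClasses X (2 * 2) 1 →
        c ∈ algebraicClasses X 2)
    (hS : Theses.LimitExtension.SpecialisationOfAlgebraicity) :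
    Theses.LimitExtension.HodgeFourfolds :=
  hodgeFourfolds_of_binders hLef
    (fun X hX _p hp hyp c hc hpp ↦ mem_algebraicClasses_of_lt_of_nonempty
      (nonempty_hardLefschetzNFold_holds (n := 4) (X := X)) hX hp hyp c hc hpp)
    hDiv hS

end Summit.HodgeConjecture.HodgeConjecture.Theorems

end
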